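import Summits.Ventures.PercRepro.S2HitBounds
import Summits.Ventures.PercRepro.S2SpanCircuits

/-!
# PercRepro — S2: THE TWO-OF-THREE HITTING COUNT AND THE SPANNING COUNT AT `19` POINTS (p7, gen 16; sub-claim S2)

Tools for the rows `t ≤ 3` of the cell `(13, 6)`, at `n = 19 = 13 + 6`: a top `5`-set meets every pair-union of two distinct
circuits (`S2.top_five_inter_union_nonempty`), hence at least two of any three (**`two_of_three_of_pair_hits`**,
**`top_five_two_of_three`**); the family of `5`-sets meeting two of three circuits is counted by
`S2.ncard_subsets_two_of_three_add_le` (**`ncard_two_of_three_family_add_le`**); the pair and triple unions of three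
distinct circuits obey **`three_circuits_ncard_bounds`**; the spanning sets against three circuits of `≤ 5` points
(**`ncard_spanning_add_le_of_three_circuits_nineteen`**) with the pair-union terms capped by **`choose_six_le_of_five_le`**.
Nothing about any cell is claimed. Axioms: standard.
-/

open scoped Matroid

namespace PercRepro

namespace S2

open Set

variable {α : Type}

/-- A set meeting each of the three pair-unions `Y₁ ∪ Y₂`, `Y₁ ∪ Y₃`, `Y₂ ∪ Y₃` meets at least two of `Y₁ Y₂ Y₃`. -/
theorem two_of_three_of_pair_hits {B Y₁ Y₂ Y₃ : Set α}
    (h₁₂ : (B ∩ (Y₁ ∪ Y₂)).Nonempty) (h₁₃ : (B ∩ (Y₁ ∪ Y₃)).Nonempty) (h₂₃ : (B ∩ (Y₂ ∪ Y₃)).Nonempty) :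
    ((B ∩ Y₁).Nonempty ∧ (B ∩ Y₂).Nonempty) ∨ ((B ∩ Y₁).Nonempty ∧ (B ∩ Y₃).Nonempty) ∨
      ((B ∩ Y₂).Nonempty ∧ (B ∩ Y₃).Nonempty) := by
  by_cases hY₁ : (B ∩ Y₁).Nonempty
  · by_cases hY₂ : (B ∩ Y₂).Nonempty
    · exact Or.inl ⟨hY₁, hY₂⟩
    · refine Or.inr (Or.inl ⟨hY₁, ?_⟩)
      obtain ⟨x, hxB, hx⟩ := h₂₃
      rcases hx with hx | hx
      · exact absurd ⟨x, hxB, hx⟩ hY₂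
      · exact ⟨x, hxB, hx⟩
  · have h₂ : (B ∩ Y₂).Nonempty := by
      obtain ⟨x, hxB, hx⟩ := h₁₂
      rcases hx with hx | hx
      · exact absurd ⟨x, hxB, hx⟩ hY₁
      · exact ⟨x, hxB, hx⟩
    have h₃ : (B ∩ Y₃).Nonempty := by
      obtain ⟨x, hxB, hx⟩ := h₁₃
      rcases hx with hx | hx
      · exact absurd ⟨x, hxB, hx⟩ hY₁
      · exact ⟨x, hxB, hx⟩
    exact Or.inr (Or.inr ⟨h₂, h₃⟩)

/-- **A top `5`-set meets at least two of any three distinct circuits** of a core of corank `6`. -/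
theorem top_five_two_of_three (M : Matroid α) [M.Finite] {p : ℕ} (hR : M.eRank = (p : ℕ∞))
    (hn : M.E.ncard = p + 6) {C₁ C₂ C₃ : Set α} (h₁ : M.IsCircuit C₁) (h₂ : M.IsCircuit C₂) (h₃ : M.IsCircuit C₃)
    (h12 : C₁ ≠ C₂) (h13 : C₁ ≠ C₃) (h23 : C₂ ≠ C₃) :
    ∀ B ⊆ M.E, B.ncard = 5 → M.eRk (M.E \ B) = M.eRank →
      (((B ∩ C₁).Nonempty ∧ (B ∩ C₂).Nonempty) ∨ ((B ∩ C₁).Nonempty ∧ (B ∩ C₃).Nonempty) ∨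
        ((B ∩ C₂).Nonempty ∧ (B ∩ C₃).Nonempty)) := by
  intro B hBE hB5 hBs
  exact two_of_three_of_pair_hits (top_five_inter_union_nonempty M hR hn h₁ h₂ h12 B hBE hB5 hBs)
    (top_five_inter_union_nonempty M hR hn h₁ h₃ h13 B hBE hB5 hBs)
    (top_five_inter_union_nonempty M hR hn h₂ h₃ h23 B hBE hB5 hBs)

/-- **The top `5`-sets lie in the two-of-three family.** -/
theorem ncard_top_five_le_two_of_three (M : Matroid α) [M.Finite] {C₁ C₂ C₃ : Set α}
    (hh : ∀ B ⊆ M.E, B.ncard = 5 → M.eRk (M.E \ B) = M.eRank →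
      (((B ∩ C₁).Nonempty ∧ (B ∩ C₂).Nonempty) ∨ ((B ∩ C₁).Nonempty ∧ (B ∩ C₃).Nonempty) ∨
        ((B ∩ C₂).Nonempty ∧ (B ∩ C₃).Nonempty))) :
    {B : Set α | B ⊆ M.E ∧ B.ncard = 5 ∧ M.eRk B = 5 ∧ M.eRk (M.E \ B) = M.eRank}.ncard ≤
      {X : Set α | X ⊆ M.E ∧ X.ncard = 5 ∧
        (((X ∩ C₁).Nonempty ∧ (X ∩ C₂).Nonempty) ∨ ((X ∩ C₁).Nonempty ∧ (X ∩ C₃).Nonempty) ∨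
          ((X ∩ C₂).Nonempty ∧ (X ∩ C₃).Nonempty))}.ncard := by
  refine Set.ncard_le_ncard ?_ (M.ground_finite.finite_subsets.subset (fun X hX => hX.1))
  rintro B ⟨hBE, hB5, -, hBs⟩
  exact ⟨hBE, hB5, hh B hBE hB5 hBs⟩

/-- **The two-of-three family at `19` points**, against the complements of the unions. -/
theorem ncard_two_of_three_family_add_le (M : Matroid α) [M.Finite] (hn : M.E.ncard = 19)
    {C₁ C₂ C₃ : Set α} (h₁ : C₁ ⊆ M.E) (h₂ : C₂ ⊆ M.E) (h₃ : C₃ ⊆ M.E) :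
    {X : Set α | X ⊆ M.E ∧ X.ncard = 5 ∧
        (((X ∩ C₁).Nonempty ∧ (X ∩ C₂).Nonempty) ∨ ((X ∩ C₁).Nonempty ∧ (X ∩ C₃).Nonempty) ∨
          ((X ∩ C₂).Nonempty ∧ (X ∩ C₃).Nonempty))}.ncard +
      (19 - (C₁ ∪ C₂).ncard).choose 5 + (19 - (C₁ ∪ C₃).ncard).choose 5 + (19 - (C₂ ∪ C₃).ncard).choose 5 ≤
      11628 + 2 * (19 - (C₁ ∪ C₂ ∪ C₃).ncard).choose 5 := by
  have hcount := ncard_subsets_two_of_three_add_le M.E C₁ C₂ C₃ M.ground_finite 5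
  have e12 : (M.E \ (C₁ ∪ C₂)).ncard = 19 - (C₁ ∪ C₂).ncard := by
    have := Set.ncard_sdiff_add_ncard_of_subset (Set.union_subset h₁ h₂) M.ground_finite
    omega
  have e13 : (M.E \ (C₁ ∪ C₃)).ncard = 19 - (C₁ ∪ C₃).ncard := by
    have := Set.ncard_sdiff_add_ncard_of_subset (Set.union_subset h₁ h₃) M.ground_finite
    omega
  have e23 : (M.E \ (C₂ ∪ C₃)).ncard = 19 - (C₂ ∪ C₃).ncard := by
    have := Set.ncard_sdiff_add_ncard_of_subset (Set.union_subset h₂ h₃) M.ground_finite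
    omega
  have e123 : (M.E \ (C₁ ∪ C₂ ∪ C₃)).ncard = 19 - (C₁ ∪ C₂ ∪ C₃).ncard := by
    have := Set.ncard_sdiff_add_ncard_of_subset (Set.union_subset (Set.union_subset h₁ h₂) h₃) M.ground_finite
    omega
  rw [hn, e12, e13, e23, e123, show (19 : ℕ).choose 5 = 11628 by norm_num [Nat.choose]] at hcount
  exact hcount

/-- **The pair and triple unions of three distinct circuits**: `|C_i ∪ C_j| ≤ |C_i| + |C_j|`, `|C_i| + 1 ≤ |C_i ∪ C_j|`,
every pair union is at most the triple union, and `Σ |C_i ∪ C_j| ≤ |C₁ ∪ C₂ ∪ C₃| + Σ |C_i|`. -/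
theorem three_circuits_ncard_bounds (M : Matroid α) [M.Finite] {C₁ C₂ C₃ : Set α}
    (h₁ : M.IsCircuit C₁) (h₂ : M.IsCircuit C₂) (h₃ : M.IsCircuit C₃) (h12 : C₁ ≠ C₂) (h13 : C₁ ≠ C₃) (h23 : C₂ ≠ C₃) :
    (C₁ ∪ C₂).ncard ≤ C₁.ncard + C₂.ncard ∧ (C₁ ∪ C₃).ncard ≤ C₁.ncard + C₃.ncard ∧
      (C₂ ∪ C₃).ncard ≤ C₂.ncard + C₃.ncard ∧
      C₁.ncard + 1 ≤ (C₁ ∪ C₂).ncard ∧ C₂.ncard + 1 ≤ (C₁ ∪ C₂).ncard ∧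
      C₁.ncard + 1 ≤ (C₁ ∪ C₃).ncard ∧ C₃.ncard + 1 ≤ (C₁ ∪ C₃).ncard ∧
      C₂.ncard + 1 ≤ (C₂ ∪ C₃).ncard ∧ C₃.ncard + 1 ≤ (C₂ ∪ C₃).ncard ∧
      (C₁ ∪ C₂).ncard ≤ (C₁ ∪ C₂ ∪ C₃).ncard ∧ (C₁ ∪ C₃).ncard ≤ (C₁ ∪ C₂ ∪ C₃).ncard ∧
      (C₂ ∪ C₃).ncard ≤ (C₁ ∪ C₂ ∪ C₃).ncard ∧
      (C₁ ∪ C₂).ncard + (C₁ ∪ C₃).ncard + (C₂ ∪ C₃).ncard ≤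
        (C₁ ∪ C₂ ∪ C₃).ncard + C₁.ncard + C₂.ncard + C₃.ncard := by
  have f₁ : C₁.Finite := M.ground_finite.subset h₁.subset_ground
  have f₂ : C₂.Finite := M.ground_finite.subset h₂.subset_ground
  have f₃ : C₃.Finite := M.ground_finite.subset h₃.subset_ground
  have i12 := ncard_inter_add_one_le_of_isCircuit_ne M h₁ h₂ h12
  have i21 := ncard_inter_add_one_le_of_isCircuit_ne M h₂ h₁ (Ne.symm h12)
  have i13 := ncard_inter_add_one_le_of_isCircuit_ne M h₁ h₃ h13
  have i31 := ncard_inter_add_one_le_of_isCircuit_ne M h₃ h₁ (Ne.symm h13)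
  have i23 := ncard_inter_add_one_le_of_isCircuit_ne M h₂ h₃ h23
  have i32 := ncard_inter_add_one_le_of_isCircuit_ne M h₃ h₂ (Ne.symm h23)
  rw [Set.inter_comm] at i21 i31 i32
  have u12 := Set.ncard_union_add_ncard_inter C₁ C₂ f₁ f₂
  have u13 := Set.ncard_union_add_ncard_inter C₁ C₃ f₁ f₃
  have u23 := Set.ncard_union_add_ncard_inter C₂ C₃ f₂ f₃
  have hU : (C₁ ∪ C₂ ∪ C₃).Finite := (f₁.union f₂).union f₃
  have t1 := ncard_union_le_union_three_left C₁ C₂ C₃ hU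
  have t2 := ncard_union_le_union_three_mid C₁ C₂ C₃ hU
  have t3 := ncard_union_le_union_three_right C₁ C₂ C₃ hU
  have t4 := ncard_union_three_add_le C₁ C₂ C₃ f₁ f₂ f₃
  refine ⟨Set.ncard_union_le _ _, Set.ncard_union_le _ _, Set.ncard_union_le _ _, ?_, ?_, ?_, ?_, ?_, ?_, t1, t2, t3, t4⟩ <;>
    omega

/-- `C(19 − u, 6) ≤ C(14, 6) = 3003` once `5 ≤ u`. -/
theorem choose_six_le_of_five_le {u : ℕ} (hu : 5 ≤ u) : (19 - u).choose 6 ≤ 3003 := by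
  have := Nat.choose_le_choose 6 (show 19 - u ≤ 14 by omega)
  norm_num [Nat.choose] at this
  exact this

/-- **The spanning sets of a `(13, 6)` core against three circuits of `≤ 5` points.** -/
theorem ncard_spanning_add_le_of_three_circuits_nineteen (M : Matroid α) [M.Finite]
    (hR : M.eRank = ((13 : ℕ) : ℕ∞)) (hn : M.E.ncard = 13 + 6)
    {C₁ C₂ C₃ : Set α} (h₁ : M.IsCircuit C₁) (h₂ : M.IsCircuit C₂) (h₃ : M.IsCircuit C₃)
    (hc₁ : C₁.ncard ≤ 5) (hc₂ : C₂.ncard ≤ 5) (hc₃ : C₃.ncard ≤ 5) :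
    {X : Set α | X ⊆ M.E ∧ M.eRk X = M.eRank}.ncard +
        (19 - C₁.ncard).choose 6 + (19 - C₂.ncard).choose 6 + (19 - C₃.ncard).choose 6 ≤
      43796 + (19 - (C₁ ∪ C₂).ncard).choose 6 + (19 - (C₁ ∪ C₃).ncard).choose 6 + (19 - (C₂ ∪ C₃).ncard).choose 6 := by
  have u12 := Set.ncard_union_le C₁ C₂
  have u13 := Set.ncard_union_le C₁ C₃
  have u23 := Set.ncard_union_le C₂ C₃
  have hS := ncard_spanning_add_le_of_three_circuits M hR hn h₁ h₂ h₃ (by omega) (by omega) (by omega)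
    (by omega) (by omega) (by omega)
  norm_num [Finset.sum_range_succ, Nat.choose] at hS
  exact hS

end S2

end PercRepro
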